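import Summits.BirchSwinnertonDyer.BirchSwinnertonDyer.Theorems.KimAtThreeDeepLowerOffStratumLevelLoweringVatsalRows
import Literature.NumberTheory.EllipticCurves.NewformsLevelRaising
import Literature.NumberTheory.EllipticCurves.NewformsHeckeProofs
import Literature.NumberTheory.EllipticCurves.ModularSymbolsPeriodHomology
import Literature.NumberTheory.EllipticCurves.PAdicLFunctionDistributionProofs
import HarnessLib

/-!
# Route `KimAtThreeKolyvagin` (rung W2), crux `DeepLowerAtThreeOffKatoStratum` (item 19679), registered
# stub `stub_nonAdditive`, ROAD (b): THEOREM B — the `q`-STABILISED OLD FORM `g' = ι₁ g − β·ι_q g` of a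
# level-`N/q` newform in the tree's `CuspForm` currency (eigenform, `q`-expansion, congruences, plus symbol)

Cell `bsd-addord`, seat `bsd-addord-w2-acc2` (PROGRAMME PART 1b, ACCEL-LIST row (2)), gen 4; item
`stmt-BirchSwinnertonDyer-19679` (OWNER w2-c2 assembles; `--supports`, closes nothing). Third file of ROAD (b)
(after `…LevelLoweringVatsal` = THEOREM A core and `…LevelLoweringVatsalRows` = the rows from the named facts
`vatsal1999_plusSymbol_congruence` / `greenbergVatsal2000_plusSymbol_congruence`). Those rows display the
level-`N` eigenform `g'` congruent to `D₀.f` and the OLD SHAPE of its plus symbol. THIS FILE constructs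
`g'` from a NEWFORM `g ∈ S₂(Γ₀(M))` (`IsNewform0 g`), a prime `q ∤ M` and a root `β` of
`X² − a_q(g)X + q`, as `g' := ι₁ g − β·ι_q g ∈ S₂(Γ₀(Mq))` with the tree's degeneracy maps
`iota M (Mq) d 2` (`NewformsLevelRaising`), and proves — theorems only, no definition, no fact, no `sorry`:

* §1 `cuspCoeff_stab`: `aₙ(g') = aₙ(g) − β·𝟙_{q∣n} a_{n/q}(g)` (`qExpansion_coeff_iota`); `isNormalized_stab`.
* §2 `heckeT_stab_of_ne`: `T_ℓ g' = a_ℓ(g)·g'` for every prime `ℓ ≠ q` (the `q`-expansion of `T_ℓ`,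
  `qExpansion_coeff_heckeT_holds`, against the Hecke recursion of `g`, `cuspCoeff_mul_cuspCoeff`);
  `heckeT_stab_self`: `U_q g' = (a_q(g) − β)·g'` when `β² − a_q(g)β + q = 0`; `isHeckeEigenform_stab`;
  `cuspCoeff_stab_prime` (`a_ℓ(g') = a_ℓ(g)`, `a_q(g') = a_q(g) − β = α`).
* §3 `valuation_cuspCoeff_sub_lt_one_of_prime`: two normalised Hecke eigenforms of the SAME level `Γ₀(L)`
  with `3`-integral coefficients and congruent PRIME coefficients have congruent coefficients (strong
  induction through the Hecke recursion — the congruence analogue of the tree's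
  `qExpansion_coeff_eq_of_heckeEigenvalue_eq`; Diamond–Shurman Prop. 5.8.5). This feeds Vatsal's hypothesis
  «`aₙ(f) ≡ aₙ(g')` for ALL `n`» from congruences at primes.
* §4 `modularSymbol_iota`: `{∞, r}_{ι_q g} = q⁻¹{∞, qr}_g` (`coe_iota` + `modularSymbol_slash_tpD`,
  substitution `s = qt` on the ray); `plusSymbol_stab`: `plusSymbol g' x = plusSymbol g x − (β/q)·plusSymbol g (qx)`
  — the OLD SHAPE with `Φ = plusSymbol g`, `c = β/q`.

In print this is the standard `q`-stabilisation (Greenberg–Vatsal 2000 §3, Lemma (3.6) context; Mazur–Tate–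
Teitelbaum §I.10 for `p`-stabilisation; Diamond–Shurman §5.7 for `ι_d`); here it is elementary algebra on
Mathlib's `CuspForm`. The sequel `…VatsalStabRows` combines it with THEOREM A. BSD is not proved by any
of this; nothing is booked.

## References

* F. Diamond, J. Shurman, *A First Course in Modular Forms* (2005), §5.7, Prop. 5.2.2, Prop. 5.8.5. [DiamondShurman2005]
* R. Greenberg, V. Vatsal, Invent. Math. 142 (2000), §3 (17)–(19), Lemma (3.6). [GreenbergVatsal2000]
* J. E. Cremona, *Algorithms for modular elliptic curves* (1997), §2.4. [CremonaAlgorithms1997]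
* B. Mazur, J. Tate, J. Teitelbaum, Invent. Math. 84 (1986), §I.4 (4.2), §I.10. [MazurTateTeitelbaum1986Invent]
-/

set_option autoImplicit false
-- the Theorems namespace of a single-conjunct summit repeats the summit name by design (D-0017)
set_option linter.dupNamespace false

noncomputable section

open scoped MatrixGroups ModularForm Classical NNReal

open CongruenceSubgroup WeierstrassCurve Literature.NumberTheory.EllipticCurves
  Literature.NumberTheory.EllipticCurves.ModularForms MeasureTheory Set
open UpperHalfPlane hiding I

namespace Summit.BirchSwinnertonDyer.BirchSwinnertonDyer.Theorems.KimAtThreeDeepLowerOffStratumLevelLoweringVatsalStab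

open Summit.BirchSwinnertonDyer.BirchSwinnertonDyer.Theorems.KimAtThreeDeepLowerOffStratumLevelLoweringVatsal

/-! ### §1 The `q`-stabilised old form `g' = ι₁ g − β·ι_q g ∈ S₂(Γ₀(Mq))`: `q`-expansion -/

section QExp

variable {M q : ℕ} [NeZero q] (g : CuspForm (Gamma0 M) 2) (β : ℂ) (h1 : M * 1 ∣ M * q) (hMq : M * q ∣ M * q)

/-- **`q`-expansion of the stabilised form**: `aₙ(ι₁ g − β ι_q g) = aₙ(g) − β·𝟙_{q ∣ n} a_{n/q}(g)`
(`ι_d (Σ aₙ qⁿ) = Σ aₙ q^{dn}`, Diamond–Shurman §5.7). [cite: DiamondShurman2005, §5.7 (ι_d on Fourier expansions)] -/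
theorem cuspCoeff_stab (n : ℕ) :
    cuspCoeff (iota M (M * q) 1 2 h1 g - β • iota M (M * q) q 2 hMq g) n =
      cuspCoeff g n - β * (if q ∣ n then cuspCoeff g (n / q) else 0) := by
  simp only [cuspCoeff, qExpansion_coeff_sub_smul, qExpansion_coeff_iota, one_dvd, if_true, Nat.div_one]

/-- The stabilised form is normalised (`a₁ = 1`) when `g` is and `q ≠ 1`. [folklore] -/
theorem isNormalized_stab (hg1 : IsNormalized g) (hq : q.Prime) :
    IsNormalized (iota M (M * q) 1 2 h1 g - β • iota M (M * q) q 2 hMq g) := by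
  rw [isNormalized_iff_cuspCoeff_one, cuspCoeff_stab, if_neg hq.not_dvd_one, mul_zero, sub_zero]
  exact hg1

end QExp

/-! ### §2 The stabilised form is a Hecke eigenform at level `Mq` (`q ∤ M` prime, `g` a newform,
`β² − a_q(g)β + q = 0`): `T_ℓ g' = a_ℓ(g) g'` (`ℓ ≠ q`), `U_q g' = (a_q(g) − β) g'` -/

section Hecke

variable {M q : ℕ} [NeZero M] [NeZero q] [NeZero (M * q)] {g : CuspForm (Gamma0 M) 2} (hg : IsNewform0 g)
  (β : ℂ) (h1 : M * 1 ∣ M * q) (hMq : M * q ∣ M * q)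
include hg

/-- `a_ℓ(g)·aₘ(g) = a_{ℓm}(g) + 𝟙_{ℓ ∤ M} ℓ 𝟙_{ℓ ∣ m} a_{m/ℓ}(g)` for a newform `g ∈ S₂(Γ₀(M))` and a prime `ℓ`
(Hecke recursion, Diamond–Shurman Prop. 5.8.5). [cite: DiamondShurman2005, Prop. 5.2.2(a) and Prop. 5.8.5] -/
theorem cuspCoeff_mul_cuspCoeff {ℓ : ℕ} (hℓ : ℓ.Prime) (m : ℕ) :
    cuspCoeff g ℓ * cuspCoeff g m =
      cuspCoeff g (ℓ * m) + (if ℓ ∣ M then 0 else (ℓ : ℂ) * (if ℓ ∣ m then cuspCoeff g (m / ℓ) else 0)) := by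
  have h := heckeEigenvalue_mul_coeff hg.2.1 hℓ m
  rw [heckeEigenvalue_eq_coeff_of_isNormalized hg.2.2 hℓ (hg.2.1 ℓ hℓ)] at h
  simpa [cuspCoeff] using h

/-- **`T_ℓ g' = a_ℓ(g)·g'` for a prime `ℓ ≠ q`** (compare `q`-expansions: `a_n(T_ℓ h) = a_{ℓn}(h) + 𝟙 ℓ a_{n/ℓ}(h)`,
`qExpansion_coeff_heckeT_holds`, and the Hecke recursion of `g`). [cite: DiamondShurman2005, Prop. 5.2.2(a) and §5.7] -/
theorem heckeT_stab_of_ne (hq : q.Prime) {ℓ : ℕ} [NeZero ℓ] (hℓ : ℓ.Prime) (hℓq : ℓ ≠ q) :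
    heckeT (Gamma0 (M * q)) 2 ℓ (iota M (M * q) 1 2 h1 g - β • iota M (M * q) q 2 hMq g) =
      cuspCoeff g ℓ • (iota M (M * q) 1 2 h1 g - β • iota M (M * q) q 2 hMq g) := by
  set g' := iota M (M * q) 1 2 h1 g - β • iota M (M * q) q 2 hMq g with hg'
  refine sub_eq_zero.mp (eq_zero_of_qExpansion_coeff_eq_zero_level0 _ fun n => ?_)
  rw [qExpansion_coeff_sub_smul, sub_eq_zero, qExpansion_coeff_heckeT_holds (M * q) 2 g' ℓ hℓ n]
  have hco : ∀ m : ℕ, (qExpansion 1 ⇑g').coeff m = cuspCoeff g m - β * (if q ∣ m then cuspCoeff g (m / q) else 0) :=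
    fun m => cuspCoeff_stab g β h1 hMq m
  have hℓMq : (ℓ ∣ M * q) ↔ ℓ ∣ M := by
    refine ⟨fun h => ?_, fun h => h.mul_right q⟩
    rcases (Nat.Prime.dvd_mul hℓ).mp h with h' | h'
    · exact h'
    · exact absurd ((Nat.prime_dvd_prime_iff_eq hℓ hq).mp h') hℓq
  have hcop : Nat.Coprime ℓ q := (Nat.coprime_primes hℓ hq).mpr hℓq
  have h21 : ((2 : ℤ) - 1) = 1 := by norm_num
  simp only [hco, hℓMq, h21, zpow_one]
  by_cases hqn : q ∣ n
  · obtain ⟨m, rfl⟩ := hqn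
    have e1 : ℓ * (q * m) / q = ℓ * m := by
      rw [show ℓ * (q * m) = q * (ℓ * m) by ring, Nat.mul_div_cancel_left _ hq.pos]
    have e2 : q * m / q = m := Nat.mul_div_cancel_left _ hq.pos
    have hqlm : q ∣ ℓ * (q * m) := ⟨ℓ * m, by ring⟩
    have hℓqm : (ℓ ∣ q * m) ↔ ℓ ∣ m := ⟨fun h => hcop.dvd_of_dvd_mul_left h, fun h => h.mul_left q⟩
    rw [if_pos hqlm, e1, if_pos (dvd_mul_right q m), e2]
    have R1 := cuspCoeff_mul_cuspCoeff hg hℓ (q * m)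
    have R2 := cuspCoeff_mul_cuspCoeff hg hℓ m
    by_cases hℓm : ℓ ∣ m
    · obtain ⟨r, rfl⟩ := hℓm
      have e3 : q * (ℓ * r) / ℓ = q * r := by
        rw [show q * (ℓ * r) = ℓ * (q * r) by ring, Nat.mul_div_cancel_left _ hℓ.pos]
      have e4 : ℓ * r / ℓ = r := Nat.mul_div_cancel_left _ hℓ.pos
      have e5 : q * r / q = r := Nat.mul_div_cancel_left _ hq.pos
      have hℓn : ℓ ∣ q * (ℓ * r) := hℓqm.mpr (dvd_mul_right ℓ r)
      rw [if_pos hℓn, e3, if_pos (dvd_mul_right q r), e5]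
      rw [if_pos hℓn, e3] at R1
      rw [if_pos (dvd_mul_right ℓ r), e4] at R2
      split_ifs at R1 R2 ⊢ <;> linear_combination (-1 : ℂ) * R1 + β * R2
    · have hℓn : ¬ ℓ ∣ q * m := fun h => hℓm (hℓqm.mp h)
      rw [if_neg hℓn]
      rw [if_neg hℓn] at R1
      rw [if_neg hℓm] at R2
      split_ifs at R1 R2 ⊢ <;> linear_combination (-1 : ℂ) * R1 + β * R2
  · have hqln : ¬ q ∣ ℓ * n := fun h => hqn (hcop.symm.dvd_of_dvd_mul_left h)
    rw [if_neg hqln, if_neg hqn]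
    by_cases hℓn : ℓ ∣ n
    · obtain ⟨r, rfl⟩ := hℓn
      have e4 : ℓ * r / ℓ = r := Nat.mul_div_cancel_left _ hℓ.pos
      have hqr : ¬ q ∣ r := fun h => hqn (h.mul_left ℓ)
      have R1 := cuspCoeff_mul_cuspCoeff hg hℓ (ℓ * r)
      rw [if_pos (dvd_mul_right ℓ r), e4, if_neg hqr]
      rw [if_pos (dvd_mul_right ℓ r), e4] at R1
      split_ifs at R1 ⊢ <;> linear_combination (-1 : ℂ) * R1
    · have R1 := cuspCoeff_mul_cuspCoeff hg hℓ n
      rw [if_neg hℓn]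
      rw [if_neg hℓn] at R1
      split_ifs at R1 ⊢ <;> linear_combination (-1 : ℂ) * R1

/-- **`U_q g' = α·g'` with `α = a_q(g) − β`** when `β² − a_q(g)β + q = 0` and `q ∤ M`: `a_n(U_q g') = a_{qn}(g')
= a_{qn}(g) − β aₙ(g)`, and `α·aₙ(g') = a_q aₙ − β aₙ − 𝟙_{q∣n} a_{n/q}(β a_q − β² − q)·…` by the recursion
`a_q aₙ = a_{qn} + q 𝟙 a_{n/q}`. [cite: DiamondShurman2005, Prop. 5.2.2(a) and §5.7] -/
theorem heckeT_stab_self (hq : q.Prime) (hqM : ¬ q ∣ M) (hβ : β ^ 2 - cuspCoeff g q * β + q = 0) :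
    heckeT (Gamma0 (M * q)) 2 q (iota M (M * q) 1 2 h1 g - β • iota M (M * q) q 2 hMq g) =
      (cuspCoeff g q - β) • (iota M (M * q) 1 2 h1 g - β • iota M (M * q) q 2 hMq g) := by
  set g' := iota M (M * q) 1 2 h1 g - β • iota M (M * q) q 2 hMq g with hg'
  refine sub_eq_zero.mp (eq_zero_of_qExpansion_coeff_eq_zero_level0 _ fun n => ?_)
  rw [qExpansion_coeff_sub_smul, sub_eq_zero, qExpansion_coeff_heckeT_holds (M * q) 2 g' q hq n,
    if_pos (dvd_mul_left q M), add_zero]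
  have hco : ∀ m : ℕ, (qExpansion 1 ⇑g').coeff m = cuspCoeff g m - β * (if q ∣ m then cuspCoeff g (m / q) else 0) :=
    fun m => cuspCoeff_stab g β h1 hMq m
  rw [hco, hco, if_pos (dvd_mul_right q n), Nat.mul_div_cancel_left _ hq.pos]
  have R := cuspCoeff_mul_cuspCoeff hg hq n
  rw [if_neg hqM] at R
  by_cases hqn : q ∣ n
  · obtain ⟨m, rfl⟩ := hqn
    have e2 : q * m / q = m := Nat.mul_div_cancel_left _ hq.pos
    rw [if_pos (dvd_mul_right q m), e2]
    rw [if_pos (dvd_mul_right q m), e2] at R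
    linear_combination (-1 : ℂ) * R - cuspCoeff g m * hβ
  · rw [if_neg hqn]
    rw [if_neg hqn] at R
    linear_combination (-1 : ℂ) * R

/-- **The stabilised form is a Hecke eigenform at level `Mq`** (all `T_ℓ`, `ℓ ≠ q`, and `U_q`).
[cite: DiamondShurman2005, §5.7 and Prop. 5.8.5] -/
theorem isHeckeEigenform_stab (hq : q.Prime) (hqM : ¬ q ∣ M) (hβ : β ^ 2 - cuspCoeff g q * β + q = 0) :
    IsHeckeEigenform (iota M (M * q) 1 2 h1 g - β • iota M (M * q) q 2 hMq g) := by
  intro ℓ hℓ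
  haveI : NeZero ℓ := ⟨hℓ.ne_zero⟩
  by_cases hℓq : ℓ = q
  · subst hℓq
    exact ⟨_, heckeT_stab_self hg β h1 hMq hq hqM hβ⟩
  · exact ⟨_, heckeT_stab_of_ne hg β h1 hMq hq hℓ hℓq⟩

/-- The prime Fourier coefficients of the stabilised form: `a_ℓ(g') = a_ℓ(g)` for `ℓ ≠ q`, `a_q(g') = a_q(g) − β`.
[cite: DiamondShurman2005, §5.7 (ι_d on Fourier expansions)] -/
theorem cuspCoeff_stab_prime (hq : q.Prime) {ℓ : ℕ} (hℓ : ℓ.Prime) :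
    cuspCoeff (iota M (M * q) 1 2 h1 g - β • iota M (M * q) q 2 hMq g) ℓ =
      if ℓ = q then cuspCoeff g q - β else cuspCoeff g ℓ := by
  rw [cuspCoeff_stab]
  by_cases hℓq : ℓ = q
  · subst hℓq
    rw [if_pos dvd_rfl, Nat.div_self hq.pos, if_pos rfl, show cuspCoeff g 1 = 1 from hg.2.2, mul_one]
  · have : ¬ q ∣ ℓ := fun h => hℓq ((Nat.prime_dvd_prime_iff_eq hq hℓ).mp h).symm
    rw [if_neg this, if_neg hℓq, mul_zero, sub_zero]

end Hecke

/-! ### §3 Congruent eigenvalues ⟹ congruent coefficients (normalised eigenforms of the same level) -/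

section Congruence

variable {L : ℕ} [NeZero L] (ι : PadicAlgCl 3 ≃+* ℂ)

/-- Ultrametric bookkeeping: `v(xy − zw) < 1` if `v(x − z) < 1`, `v(y − w) < 1` and `x, w` are integral. [folklore] -/
theorem valuation_mul_sub_mul_lt_one {x y z w : PadicAlgCl 3} (hx : Valued.v x ≤ 1) (hw : Valued.v w ≤ 1)
    (hxz : Valued.v (x - z) < 1) (hyw : Valued.v (y - w) < 1) : Valued.v (x * y - z * w) < 1 := by
  have : x * y - z * w = x * (y - w) + (x - z) * w := by ring
  rw [this]
  refine lt_of_le_of_lt (Valuation.map_add _ _ _) (max_lt ?_ ?_)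
  · rw [Valuation.map_mul]
    calc Valued.v x * Valued.v (y - w) ≤ 1 * Valued.v (y - w) := mul_le_mul' hx le_rfl
      _ < 1 := by rw [one_mul]; exact hyw
  · rw [Valuation.map_mul]
    calc Valued.v (x - z) * Valued.v w ≤ Valued.v (x - z) * 1 := mul_le_mul' le_rfl hw
      _ < 1 := by rw [mul_one]; exact hxz

/-- **Two normalised Hecke eigenforms of the same level `Γ₀(L)` and weight `2` with `3`-integral coefficients
whose PRIME coefficients are congruent modulo `𝔪` have ALL coefficients congruent** (strong induction on
`n` through the Hecke recursion `a_{ℓm} = a_ℓ a_m − 𝟙_{ℓ∤L} ℓ 𝟙_{ℓ∣m} a_{m/ℓ}`, Diamond–Shurman Prop. 5.8.5;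
the shape of the tree's `qExpansion_coeff_eq_of_heckeEigenvalue_eq`, congruences in place of equalities).
[cite: DiamondShurman2005, Prop. 5.8.5] -/
theorem valuation_cuspCoeff_sub_lt_one_of_prime {h₁ h₂ : CuspForm (Gamma0 L) 2}
    (e₁ : IsHeckeEigenform h₁) (e₂ : IsHeckeEigenform h₂) (n₁ : IsNormalized h₁) (n₂ : IsNormalized h₂)
    (i₁ : ∀ n : ℕ, Valued.v (ι.symm (cuspCoeff h₁ n)) ≤ 1) (i₂ : ∀ n : ℕ, Valued.v (ι.symm (cuspCoeff h₂ n)) ≤ 1)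
    (hc : ∀ ℓ : ℕ, ℓ.Prime → Valued.v (ι.symm (cuspCoeff h₁ ℓ - cuspCoeff h₂ ℓ)) < 1) (n : ℕ) :
    Valued.v (ι.symm (cuspCoeff h₁ n - cuspCoeff h₂ n)) < 1 := by
  induction n using Nat.strong_induction_on with
  | _ n ih =>
    rcases eq_or_ne n 0 with rfl | hn0
    · rw [cuspCoeff, cuspCoeff, CuspFormClass.qExpansion_coeff_zero h₁ one_pos (one_mem_strictPeriods_gamma0 L),
        CuspFormClass.qExpansion_coeff_zero h₂ one_pos (one_mem_strictPeriods_gamma0 L), sub_zero, map_zero,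
        Valuation.map_zero]
      exact zero_lt_one
    rcases eq_or_ne n 1 with rfl | hn1
    · rw [show cuspCoeff h₁ 1 = 1 from n₁, show cuspCoeff h₂ 1 = 1 from n₂, sub_self, map_zero, Valuation.map_zero]
      exact zero_lt_one
    set ℓ := n.minFac with hℓ_def
    have hℓ : ℓ.Prime := Nat.minFac_prime hn1
    obtain ⟨m, hm⟩ : ℓ ∣ n := Nat.minFac_dvd n
    have hm0 : m ≠ 0 := by rintro rfl; simp at hm; exact hn0 hm
    have hmn : m < n := by rw [hm]; exact lt_mul_left (Nat.pos_of_ne_zero hm0) hℓ.one_lt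
    -- the recursions `a_n = a_ℓ a_m − c · 𝟙 a_{m/ℓ}` for `h₁`, `h₂`
    have hrec : ∀ {h : CuspForm (Gamma0 L) 2}, IsHeckeEigenform h → IsNormalized h →
        cuspCoeff h n = cuspCoeff h ℓ * cuspCoeff h m -
          (if ℓ ∣ L then 0 else (ℓ : ℂ) * (if ℓ ∣ m then cuspCoeff h (m / ℓ) else 0)) := by
      intro h e nn
      have hr := heckeEigenvalue_mul_coeff e hℓ m
      rw [heckeEigenvalue_eq_coeff_of_isNormalized nn hℓ (e ℓ hℓ), ← hm, show ((2 : ℤ) - 1) = 1 by norm_num,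
        zpow_one] at hr
      simp only [cuspCoeff] at hr ⊢
      rw [hr]; ring
    rw [hrec e₁ n₁, hrec e₂ n₂]
    have hA : Valued.v (ι.symm (cuspCoeff h₁ ℓ * cuspCoeff h₁ m - cuspCoeff h₂ ℓ * cuspCoeff h₂ m)) < 1 := by
      rw [map_sub, map_mul, map_mul]
      exact valuation_mul_sub_mul_lt_one (i₁ ℓ) (i₂ m) (by rw [← map_sub]; exact hc ℓ hℓ)
        (by rw [← map_sub]; exact ih m hmn)
    have hB : Valued.v (ι.symm ((if ℓ ∣ L then 0 else (ℓ : ℂ) * (if ℓ ∣ m then cuspCoeff h₁ (m / ℓ) else 0)) -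
        (if ℓ ∣ L then 0 else (ℓ : ℂ) * (if ℓ ∣ m then cuspCoeff h₂ (m / ℓ) else 0)))) < 1 := by
      split_ifs with hL hℓm
      · rw [sub_self, map_zero, Valuation.map_zero]; exact zero_lt_one
      · rw [← mul_sub, map_mul, Valuation.map_mul, map_natCast]
        have hℓint : Valued.v ((ℓ : ℕ) : PadicAlgCl 3) ≤ 1 := by
          have h3 := norm_intCast_le_one (ℓ : ℤ)
          rw [Int.cast_natCast] at h3
          exact valuation_le_one_iff.mpr h3
        have hmℓ : m / ℓ < n := lt_of_le_of_lt (Nat.div_le_self m ℓ) hmn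
        calc Valued.v ((ℓ : ℕ) : PadicAlgCl 3) * Valued.v (ι.symm (cuspCoeff h₁ (m / ℓ) - cuspCoeff h₂ (m / ℓ)))
            ≤ 1 * Valued.v (ι.symm (cuspCoeff h₁ (m / ℓ) - cuspCoeff h₂ (m / ℓ))) := mul_le_mul' hℓint le_rfl
          _ < 1 := by rw [one_mul]; exact ih (m / ℓ) hmℓ
      · rw [mul_zero, sub_self, map_zero, Valuation.map_zero]; exact zero_lt_one
    have : ι.symm (cuspCoeff h₁ ℓ * cuspCoeff h₁ m -
          (if ℓ ∣ L then 0 else (ℓ : ℂ) * (if ℓ ∣ m then cuspCoeff h₁ (m / ℓ) else 0)) -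
        (cuspCoeff h₂ ℓ * cuspCoeff h₂ m -
          (if ℓ ∣ L then 0 else (ℓ : ℂ) * (if ℓ ∣ m then cuspCoeff h₂ (m / ℓ) else 0)))) =
        ι.symm (cuspCoeff h₁ ℓ * cuspCoeff h₁ m - cuspCoeff h₂ ℓ * cuspCoeff h₂ m) -
        ι.symm ((if ℓ ∣ L then 0 else (ℓ : ℂ) * (if ℓ ∣ m then cuspCoeff h₁ (m / ℓ) else 0)) -
          (if ℓ ∣ L then 0 else (ℓ : ℂ) * (if ℓ ∣ m then cuspCoeff h₂ (m / ℓ) else 0))) := by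
      rw [← map_sub]; congr 1; ring
    rw [this]
    exact lt_of_le_of_lt (Valuation.map_sub _ _ _) (max_lt hA hB)

end Congruence

/-! ### §4 Modular symbols of the stabilised form: `{∞, x}_{ι_q g} = q⁻¹ {∞, qx}_g` -/

section Symbols

variable {M q : ℕ} [NeZero M] [NeZero q] (g : CuspForm (Gamma0 M) 2) (β : ℂ)
  (h1 : M * 1 ∣ M * q) (hMq : M * q ∣ M * q)

omit [NeZero M] [NeZero q] in
/-- `{∞, r}_{ι₁ g} = {∞, r}_g` (`ι₁ g = g` as a function). [folklore] -/
theorem modularSymbol_iota_one (r : ℚ) : modularSymbol (iota M (M * q) 1 2 h1 g) r = modularSymbol g r := by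
  have h : ∀ τ : ℍ, iota M (M * q) 1 2 h1 g τ = g τ := fun τ => by
    rw [coe_iota_apply]
    congr 1
    ext1
    simp
  simp only [modularSymbol, h]

omit [NeZero M] in
/-- **`{∞, r}_{ι_q g} = q⁻¹ {∞, q r}_g`** (`(ι_q g)(τ) = g(qτ)`; substitute `s = qt` on the vertical ray:
`modularSymbol_slash_tpD`). [cite: CremonaAlgorithms1997, §2.4] -/
theorem modularSymbol_iota (r : ℚ) :
    modularSymbol (iota M (M * q) q 2 hMq g) r = (q : ℂ)⁻¹ * modularSymbol g (q * r) := by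
  rw [← modularSymbol_slash_tpD q g r]
  simp only [modularSymbol, coe_iota, Pi.smul_apply, smul_eq_mul]
  rw [integral_const_mul, show ((1 : ℤ) - 2) = -1 by norm_num, zpow_neg_one]
  ring

/-- `{∞, r}_{g'} = {∞, r}_g − (β/q) {∞, q r}_g` for `g' = ι₁ g − β ι_q g`. [cite: CremonaAlgorithms1997, §2.4] -/
theorem modularSymbol_stab (r : ℚ) :
    modularSymbol (iota M (M * q) 1 2 h1 g - β • iota M (M * q) q 2 hMq g) r =
      modularSymbol g r - β / q * modularSymbol g (q * r) := by
  have h := modularSymbol_add (iota M (M * q) 1 2 h1 g - β • iota M (M * q) q 2 hMq g)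
    (β • iota M (M * q) q 2 hMq g) r
  rw [sub_add_cancel, modularSymbol_smul, modularSymbol_iota_one, modularSymbol_iota] at h
  linear_combination (-1 : ℂ) * h

/-- **OLD SHAPE of the plus symbol**: `plusSymbol g' x = plusSymbol g x − (β/q)·plusSymbol g (q x)`.
[cite: GreenbergVatsal2000, §3 Lemma (3.6) (shape of the q-deprived eigenform)] [cite: CremonaAlgorithms1997, §2.4] -/
theorem plusSymbol_stab (x : ℚ) :
    plusSymbol (iota M (M * q) 1 2 h1 g - β • iota M (M * q) q 2 hMq g) x =
      plusSymbol g x - β / q * plusSymbol g (q * x) := by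
  simp only [plusSymbol, modularSymbol_stab]
  rw [show (q : ℚ) * -x = -(q * x) by ring]
  ring

end Symbols

end Summit.BirchSwinnertonDyer.BirchSwinnertonDyer.Theorems.KimAtThreeDeepLowerOffStratumLevelLoweringVatsalStab

end
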